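import Summits.QuantumFields.BalabanUV.Beta.GAN24.WilsonLetterFlatCharges
import Summits.QuantumFields.BalabanUV.Beta.GAN24.HessianGaugeLegContact
import Summits.QuantumFields.BalabanUV.Beta.GAN24.ContactFaceJump

/-!
# `BalabanUV.Beta.GAN24.SrecExitChargeLevelZero` — binder row G-an2-4 ∕ (CONV-C), the (S) row of RULING R-gan24p1-g27-1 B (viii), (W-γ) ∕ the slot-constancy `hζS` one level up:
# **THE EXIT⊗EXIT SLOT-CHARGE FUNCTION OF THE LEVEL-0 STEP TABLE `SrecAt … 0` IS `−¼·cE·(d*d) m_αβ`** — the rooted constraint-Hessian tables `h^ρ_b` and hence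
# the whole Λ-letter carry NO exit⊗exit charge (any box root, any coefficient family), the border table has no ff block, and the Wilson letter's share is
# leaf-02 g55's `WilsonLetterFaceCharge` (G-an2-4 formalisation swarm → CRUX TEAM (2), leaf prover `b2b-balaban-gan24-formalise-leaf-02`, gen 56, PART 2)

NOT IN PRINT; OUR BOOKKEEPING ([folklore] packaging BY NAME of: leaf-02 g47 `HessianGaugeLegContact.tsum_dz_mul_hessFFAt ∕ tsum_dz_mul_SLam_hessFFAt` (the fluctuation-slot
`dψ`-laws of an1's rooted W-Hessian table and of the Λ-piece, EVERY `ψ`, EVERY coefficient family), leaf-01's two-block support `ContactFaceJump.linKerAt_eq_zero_of_not_twoBlock`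
+ `blk_root ∕ blk_farRoot`, leaf-02 g55 `SymLinKernelFaceSupport.int_ediv_add_one ∕ exitFace_eq_dz_blk ∕ dz_blk_of_ne`, `WilsonLetterFaceCharge.tsum_exitFace_wilsonA_exitFace_eq_neg_quarter_curvAdj
∕ _self`, `WilsonLetterFlatCharges.spureRecAt_zero_inl_inl`, an3's `ContactOneGaugeCellAlgebra.summable_mul_wilsonA`; 0 `def`, 0 cited fact, 0 `def … : Prop`, 0 sorry).
HONEST FRAMING (cell contract, verbatim): «discharging `BetaPertH` makes Bałaban's UV stability UNCONDITIONAL — a real constructive-QFT result; it is NOT the continuum limit and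
NOT the Clay problem.»  HONEST DEPENDENCY (verbatim): «continuum YM on T⁴ ⇐ BetaPertH ∧ nine spine estimates (0/9 proved); BetaPertH ⇐ (D1) ∧ (D4) ∧ CAP+tail; G-an2-4 gates
asym, D1 and NE2/3/4.»

WHY (leaf-02 g56 ONLINE N-leaf02-g56-1 (iii)).  By leaf-02 g52 `CubicPushFaceCharge.hasSum_prod_SpureRecAt_succ_inl_inl` the PLAIN ff slot charge of the level-`(j+1)` pure S table at the
slot `(κ′,u′)` is `(cE·wE_{j+1})·Lc²·σ_j²·⟨exit_α ⊗ exit_β, vertexOfK G_j Lc (SrecAt … j) κ′ u′⟩` — the ℋ-column read of the EXIT⊗EXIT SLOT-CHARGE FUNCTION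
`C^{exit}_j(κ,u;α,β) := Σ'_z 𝟙^{exit}_β(z)·Σ'_x 𝟙^{exit}_α(x)·(SrecAt … j κ u) x z (inl α)(inl β)` of the previous member (`𝟙^{exit}_c(x) := [x_c % L = L−1]`).  This file computes
`C^{exit}_0` in closed form: with `SrecAt … 0 κ u = cE•W κ u + cVH•V κ u + cΛ•SΛ κ u` (Wilson letter, border table, Λ-piece over the rooted constraint Hessians `h^ρ_b`),
* §1 `blk_add_unitVec_of_exitFace` (an exit bond steps the block label), `tsum_exitFace_mul_hessFFAt` (ONE exit leg of `h^ρ_b`: the `dψ`-law at the coarse coordinate `ψ_α = ⌊·_α∕L⌋`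
  gives the FOUR-SITE BLOCK WEIGHT `(blk x′)_α + (blk(x′+e_{α′}))_α − y_α − (y+e_μ)_α` against `q¹,ρ_b(α′,x′)∕2`), the KEY pointwise lemma
  **`fourSiteBlk_mul_exitFace_mul_linKerAt_eq_zero`** (on the two-block support of `q¹,ρ_{(μ,y)}` an exit bond `(α′,x′)` forces `α′ = μ`, `blk x′ = y`, `blk(x′+e_μ) = y+e_μ`, where the
  four-site weight is `0`), hence **`tsum_exitFace_tsum_exitFace_hessFFAt_eq_zero`** (`⟨exit_α, h^ρ_b exit_{α′}⟩ = 0` for EVERY coarse bond `b`, EVERY box root — leaf-02 g56's exact-rational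
  check `num/hess_exit_charge.py`, D = 2,3, L = 3,5, comb and symmetrised, centred and corner roots: all `0`) and **`tsum_exitFace_tsum_exitFace_SLam_hessFFAt_eq_zero`** (the Λ-piece, ANY
  coefficient family `c`, in particular Bałaban's `lamCoeffOf KInv Lc`, is exit⊗exit-charge-free at every slot).
* §2 `srecAt_zero_inl_inl` (the ff entries of member `0`), `tsum_exitFace_mul_srecAt_zero_inl_inl` (one exit leg, linearity), and the END **`tsum_exitFace_tsum_exitFace_srecAt_zero`**:
  `C^{exit}_0(κ,u;α,β) = cE·(−¼)·(curvAdj (curv m_αβ)) κ u` with `m_αβ β z := dzψ_β β z·(ψ_α z + ψ_α(z+e_β))` (g55 PART 6's face form) — and **`…_self`**: `C^{exit}_0(κ,u;α,α) = 0`;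
  the pure-S twin `tsum_exitFace_tsum_exitFace_spureRecAt_zero` (same value: the border table is off the ff block).
READING.  `C^{exit}_0` is an explicit `u`-DEPENDENT Maxwell image; so `hζS` at level `1` (ff) reads: the ℋ-column pairing `y ↦ Σ_κ Σ'_u colH G_0(μ,y;κ,u)·((d*d) m_αβ)(κ,u)` is
slot-constant — the same relative-inverse pairing `(d*d)∘G_0` against a face potential that leaf-06 g46's `EdgePlaquettePotential` isolates for (W-γ)_exit (its bounded periodic
`m̃_αβ` has `curv m̃_αβ = ½·curv m_αβ −` const, so the same `d*d` up to the factor).  Asserts NO value of any column of `G_0`; NOTHING of (W-γ) ∕ (T-F) ∕ (INV) ∕ (S) ∕ (Q-R) ∕ (LT) ∕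
(Q-L) ∕ (C) ∕ «T2Shape» ∕ (hW, hWall) discharged; NEVER «G-an2-4 closed» as (CONV-C); NOT D1, NOT `BetaPertH`, NOT continuum, NOT Clay.  2026-08-22; no existing file touched.
-/

noncomputable section

open Finset
open scoped BigOperators
open Literature.MathematicalPhysics.QuantumFieldTheory
open Literature.MathematicalPhysics.QuantumFieldTheory.Balaban1983to89
open Literature.MathematicalPhysics.QuantumFieldTheory.Balaban1983to89.Beta
open ExpKernelCalculus (Site MKer)
open OneStepResolventKernel (Fib KInv)
open AffineAveraging (box toSite unitVec unitVec_apply dz curv curvAdj)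
open AveragingContours (blk)
open AveragingHessianKernelsRooted (vhSAt hessFFAt linKerAt)
open StepJetData (wilsonA)
open InterLevelTransport (SLam)
open BalabanStepJets (lamCoeffOf)
open Summit.QuantumFields.BalabanUV.Beta.SpineRooted (SpureRecAt SrecAt_eq_SpureRecAt_add_lam_zero)
open Summit.QuantumFields.BalabanUV.Beta.WardLocusRecursive (SrecAt)
open Summit.QuantumFields.BalabanUV.Beta.GAN24.WilsonLetterFlatCharges (spureRecAt_zero_inl_inl)
open Summit.QuantumFields.BalabanUV.Beta.GAN24.WilsonLetterFaceCharge (tsum_exitFace_wilsonA_exitFace_eq_neg_quarter_curvAdj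
  tsum_exitFace_wilsonA_exitFace_self)
open Summit.QuantumFields.BalabanUV.Beta.GAN24.SymLinKernelFaceSupport (int_ediv_add_one exitFace_eq_dz_blk dz_blk_of_ne)
open Summit.QuantumFields.BalabanUV.Beta.GAN24.FaceChargeCurlResummation (dz_blk_eq_ite)
open Summit.QuantumFields.BalabanUV.Beta.GAN24.HessianGaugeLegContact (tsum_dz_mul_hessFFAt tsum_dz_mul_SLam_hessFFAt summable_mul_SLam_hessFFAt)
open Summit.QuantumFields.BalabanUV.Beta.GAN24.ContactFaceJump (linKerAt_eq_zero_of_not_twoBlock blk_root blk_farRoot)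
open Summit.QuantumFields.BalabanUV.Beta.GAN24.ContactOneGaugeCellAlgebra (summable_mul_wilsonA)

namespace Summit.QuantumFields.BalabanUV.Beta.GAN24.SrecExitChargeLevelZero

variable {d : ℕ}

/-! ## §1 The rooted constraint-Hessian tables and the Λ-piece carry no exit⊗exit charge -/

/-- [folklore] **AN EXIT BOND STEPS THE BLOCK LABEL**: if `x_c % L = L − 1` (`1 ≤ L`) then `blk (x + e_c) = blk x + e_c`. -/
theorem blk_add_unitVec_of_exitFace {L : ℕ} (hL : 1 ≤ L) {c : Fin (d + 1)} {x : Site (d + 1)} (hx : x c % (L : ℤ) = (L : ℤ) - 1) :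
    blk L (x + unitVec c) = blk L x + unitVec c := by
  funext i
  simp only [AveragingContours.blk, Pi.add_apply, unitVec_apply]
  by_cases hi : i = c
  · subst hi
    rw [if_pos rfl, int_ediv_add_one hL, if_pos hx]
  · rw [if_neg hi, add_zero, add_zero]

/-- [folklore] The `α`-th coarse coordinate read at a site: `ψ_α w = (blk w)_α`. -/
theorem coarseCoord_eq_blk (L : ℕ) (α : Fin (d + 1)) (w : Site (d + 1)) : ((w α / (L : ℤ) : ℤ) : ℝ) = (((blk L w) α : ℤ) : ℝ) := rfl

/-- [folklore] The direction sum of the coarse-coordinate derivative against a table leg collapses to the exit-face indicator of the read direction. -/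
theorem sum_dz_blk_mul {L : ℕ} (hL : 1 ≤ L) (α : Fin (d + 1)) (x : Site (d + 1)) (F : Fin (d + 1) → ℝ) :
    ∑ a, dz (fun z : Fin (d + 1) → ℤ => ((z α / (L : ℤ) : ℤ) : ℝ)) a x * F a = (if x α % (L : ℤ) = (L : ℤ) - 1 then (1 : ℝ) else 0) * F α := by
  simp only [dz_blk_eq_ite hL, ite_mul, zero_mul, Finset.sum_ite_eq', Finset.mem_univ, if_true]

/-- NOT IN PRINT; OUR BOOKKEEPING.  **ONE EXIT LEG OF A ROOTED CONSTRAINT-HESSIAN TABLE** (box root `ρ = toSite r`, coarse bond `(μ,y)`, exit direction `α`, other leg `(α′,x′)`):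
`Σ'_x 𝟙^{exit}_α(x)·h^ρ_{(μ,y)}((α,x),(α′,x′)) = ((blk x′)_α + (blk(x′+e_{α′}))_α − y_α − (y+e_μ)_α)·q¹,ρ_{(μ,y)}(α′,x′)∕2` — the `dψ`-law at the coarse coordinate `ψ_α`, whose values
at the root `L•y+ρ` and the far root are `y_α`, `(y+e_μ)_α` (leaf-01's `blk_root ∕ blk_farRoot`). -/
theorem tsum_exitFace_mul_hessFFAt {L : ℕ} (hL : 1 ≤ L) {r : Fin (d + 1) → ℕ} (hr : r ∈ box (d + 1) L) (μ : Fin (d + 1)) (y x' : Site (d + 1))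
    (α α' : Fin (d + 1)) :
    ∑' x, (if x α % (L : ℤ) = (L : ℤ) - 1 then (1 : ℝ) else 0) * hessFFAt (toSite r) L μ y x x' (Sum.inl α) (Sum.inl α')
      = ((((blk L x') α : ℤ) : ℝ) + (((blk L (x' + unitVec α')) α : ℤ) : ℝ) - ((y α : ℤ) : ℝ) - (((y + unitVec μ) α : ℤ) : ℝ))
        * linKerAt (toSite r) L μ y (α', x') / 2 := by
  have h := tsum_dz_mul_hessFFAt hL hr μ y x' α' (fun z : Fin (d + 1) → ℤ => ((z α / (L : ℤ) : ℤ) : ℝ))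
  simp only [sum_dz_blk_mul hL] at h
  rw [h, coarseCoord_eq_blk, coarseCoord_eq_blk, coarseCoord_eq_blk, coarseCoord_eq_blk, blk_root y hr, blk_farRoot y μ hr]

/-- NOT IN PRINT; OUR BOOKKEEPING.  **THE KEY POINTWISE LEMMA**: on the two-block support of `q¹,ρ_{(μ,y)}` (both endpoints of the bond in the blocks `y`, `y+e_μ`) an EXIT bond `(α′,x′)`
(`x′_{α′} % L = L−1`, so `blk(x′+e_{α′}) = blk x′ + e_{α′}`) must be the `μ`-bond leaving block `y` (`α′ = μ`, `blk x′ = y`), where the four-site block weight of EVERY direction `α` vanishes: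
`((blk x′)_α + (blk(x′+e_{α′}))_α − y_α − (y+e_μ)_α)·𝟙^{exit}_{α′}(x′)·q¹,ρ_{(μ,y)}(α′,x′) = 0`. -/
theorem fourSiteBlk_mul_exitFace_mul_linKerAt_eq_zero {L : ℕ} (hL : 1 ≤ L) {r : Fin (d + 1) → ℕ} (hr : r ∈ box (d + 1) L) (μ : Fin (d + 1))
    (y x' : Site (d + 1)) (α α' : Fin (d + 1)) :
    ((((blk L x') α : ℤ) : ℝ) + (((blk L (x' + unitVec α')) α : ℤ) : ℝ) - ((y α : ℤ) : ℝ) - (((y + unitVec μ) α : ℤ) : ℝ))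
      * (if x' α' % (L : ℤ) = (L : ℤ) - 1 then (1 : ℝ) else 0) * linKerAt (toSite r) L μ y (α', x') = 0 := by
  by_cases hx : x' α' % (L : ℤ) = (L : ℤ) - 1
  · rw [if_pos hx, mul_one]
    by_cases hq : linKerAt (toSite r) L μ y (α', x') = 0
    · rw [hq, mul_zero]
    · -- the two-block support
      have hsupp : (blk L x' = y ∨ blk L x' = y + unitVec μ) ∧ (blk L (x' + unitVec α') = y ∨ blk L (x' + unitVec α') = y + unitVec μ) := by
        by_contra h
        exact hq (linKerAt_eq_zero_of_not_twoBlock hL hr h)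
      rw [blk_add_unitVec_of_exitFace hL hx] at hsupp ⊢
      obtain ⟨h1, h2⟩ := hsupp
      have hne1 : ∀ v : Site (d + 1), v + unitVec α' ≠ v := fun v h => by
        have := congrFun h α'
        simp only [Pi.add_apply, unitVec_apply, if_true] at this
        omega
      rcases h1 with h1 | h1
      · rw [h1] at h2 ⊢
        rcases h2 with h2 | h2
        · exact absurd h2 (hne1 y)
        · -- `y + e_{α′} = y + e_μ` forces `α′ = μ`; then the weight vanishes
          have hαμ : unitVec (d := d + 1) α' = unitVec μ := add_left_cancel h2
          rw [hαμ]
          simp only [Pi.add_apply]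
          push_cast
          ring
      · rw [h1] at h2
        exfalso
        rcases h2 with h2 | h2
        · have := congrFun h2 μ
          simp only [Pi.add_apply, unitVec_apply, if_true] at this
          split_ifs at this <;> omega
        · exact hne1 _ h2
  · rw [if_neg hx, mul_zero, zero_mul]

/-- NOT IN PRINT; OUR BOOKKEEPING.  **EVERY ROOTED CONSTRAINT-HESSIAN TABLE IS EXIT⊗EXIT-CHARGE-FREE** (box root, every coarse bond `(μ,y)`, every channel `(α, α′)`):
`Σ'_{x′} 𝟙^{exit}_{α′}(x′)·Σ'_x 𝟙^{exit}_α(x)·h^ρ_{(μ,y)}((α,x),(α′,x′)) = 0`. -/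
theorem tsum_exitFace_tsum_exitFace_hessFFAt_eq_zero {L : ℕ} (hL : 1 ≤ L) {r : Fin (d + 1) → ℕ} (hr : r ∈ box (d + 1) L) (μ : Fin (d + 1)) (y : Site (d + 1))
    (α α' : Fin (d + 1)) :
    ∑' x', (if x' α' % (L : ℤ) = (L : ℤ) - 1 then (1 : ℝ) else 0) *
        ∑' x, (if x α % (L : ℤ) = (L : ℤ) - 1 then (1 : ℝ) else 0) * hessFFAt (toSite r) L μ y x x' (Sum.inl α) (Sum.inl α') = 0 := by
  simp only [tsum_exitFace_mul_hessFFAt hL hr]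
  have e : ∀ x' : Site (d + 1), (if x' α' % (L : ℤ) = (L : ℤ) - 1 then (1 : ℝ) else 0)
      * (((((blk L x') α : ℤ) : ℝ) + (((blk L (x' + unitVec α')) α : ℤ) : ℝ) - ((y α : ℤ) : ℝ) - (((y + unitVec μ) α : ℤ) : ℝ))
        * linKerAt (toSite r) L μ y (α', x') / 2) = 0 := fun x' => by
    have h := fourSiteBlk_mul_exitFace_mul_linKerAt_eq_zero hL hr μ y x' α α'
    have : (if x' α' % (L : ℤ) = (L : ℤ) - 1 then (1 : ℝ) else 0)
        * (((((blk L x') α : ℤ) : ℝ) + (((blk L (x' + unitVec α')) α : ℤ) : ℝ) - ((y α : ℤ) : ℝ) - (((y + unitVec μ) α : ℤ) : ℝ))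
          * linKerAt (toSite r) L μ y (α', x') / 2)
        = (((((blk L x') α : ℤ) : ℝ) + (((blk L (x' + unitVec α')) α : ℤ) : ℝ) - ((y α : ℤ) : ℝ) - (((y + unitVec μ) α : ℤ) : ℝ))
          * (if x' α' % (L : ℤ) = (L : ℤ) - 1 then (1 : ℝ) else 0) * linKerAt (toSite r) L μ y (α', x')) / 2 := by ring
    rw [this, h, zero_div]
  simp only [e, tsum_zero]

variable {N : ℕ} [NeZero N]

/-- NOT IN PRINT; OUR BOOKKEEPING.  **ONE EXIT LEG OF THE Λ-PIECE** (box root; ANY placement `N`, ANY coefficient family `c`):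
`Σ'_x 𝟙^{exit}_α(x)·SΛ κ u x x′ (inl α)(inl α′) = −Σ_μ Σ'_y c μ y κ u·(((blk x′)_α + (blk(x′+e_{α′}))_α − y_α − (y+e_μ)_α)·q¹,ρ_{(μ,y)}(α′,x′)∕2)`. -/
theorem tsum_exitFace_mul_SLam_hessFFAt {L : ℕ} (hL : 1 ≤ L) {r : Fin (d + 1) → ℕ} (hr : r ∈ box (d + 1) L)
    (c : Fin (d + 1) → (Fin (d + 1) → ℤ) → Fin (d + 1) → (Fin (d + 1) → ℤ) → ℝ) (κ : Fin (d + 1)) (u x' : Site (d + 1)) (α α' : Fin (d + 1)) :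
    ∑' x, (if x α % (L : ℤ) = (L : ℤ) - 1 then (1 : ℝ) else 0) * SLam N c (fun μ y => hessFFAt (toSite r) L μ y) κ u x x' (Sum.inl α) (Sum.inl α')
      = -∑ μ, ∑' y, c μ y κ u *
          (((((blk L x') α : ℤ) : ℝ) + (((blk L (x' + unitVec α')) α : ℤ) : ℝ) - ((y α : ℤ) : ℝ) - (((y + unitVec μ) α : ℤ) : ℝ))
            * linKerAt (toSite r) L μ y (α', x') / 2) := by
  have h := tsum_dz_mul_SLam_hessFFAt (N := N) hL hr c κ u x' α' (fun z : Fin (d + 1) → ℤ => ((z α / (L : ℤ) : ℤ) : ℝ))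
  simp only [sum_dz_blk_mul hL] at h
  rw [h]
  refine congrArg Neg.neg (Finset.sum_congr rfl fun μ _ => tsum_congr fun y => ?_)
  rw [coarseCoord_eq_blk, coarseCoord_eq_blk, coarseCoord_eq_blk, coarseCoord_eq_blk, blk_root y hr, blk_farRoot y μ hr]

/-- NOT IN PRINT; OUR BOOKKEEPING.  **POINTWISE IN THE SECOND LEG**: `𝟙^{exit}_{α′}(x′)·Σ'_x 𝟙^{exit}_α(x)·SΛ κ u x x′ (inl α)(inl α′) = 0` — each coarse-bond term dies by the KEY lemma. -/
theorem exitFace_mul_tsum_exitFace_SLam_hessFFAt_eq_zero {L : ℕ} (hL : 1 ≤ L) {r : Fin (d + 1) → ℕ} (hr : r ∈ box (d + 1) L)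
    (c : Fin (d + 1) → (Fin (d + 1) → ℤ) → Fin (d + 1) → (Fin (d + 1) → ℤ) → ℝ) (κ : Fin (d + 1)) (u x' : Site (d + 1)) (α α' : Fin (d + 1)) :
    (if x' α' % (L : ℤ) = (L : ℤ) - 1 then (1 : ℝ) else 0) *
        ∑' x, (if x α % (L : ℤ) = (L : ℤ) - 1 then (1 : ℝ) else 0) * SLam N c (fun μ y => hessFFAt (toSite r) L μ y) κ u x x' (Sum.inl α) (Sum.inl α') = 0 := by
  rw [tsum_exitFace_mul_SLam_hessFFAt hL hr, mul_neg, Finset.mul_sum, neg_eq_zero]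
  refine Finset.sum_eq_zero fun μ _ => ?_
  rw [← tsum_mul_left]
  refine tsum_congr (fun y => ?_) |>.trans tsum_zero
  have h := fourSiteBlk_mul_exitFace_mul_linKerAt_eq_zero hL hr μ y x' α α'
  have : (if x' α' % (L : ℤ) = (L : ℤ) - 1 then (1 : ℝ) else 0) * (c μ y κ u *
        (((((blk L x') α : ℤ) : ℝ) + (((blk L (x' + unitVec α')) α : ℤ) : ℝ) - ((y α : ℤ) : ℝ) - (((y + unitVec μ) α : ℤ) : ℝ))
          * linKerAt (toSite r) L μ y (α', x') / 2))
      = c μ y κ u * ((((((blk L x') α : ℤ) : ℝ) + (((blk L (x' + unitVec α')) α : ℤ) : ℝ) - ((y α : ℤ) : ℝ) - (((y + unitVec μ) α : ℤ) : ℝ))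
          * (if x' α' % (L : ℤ) = (L : ℤ) - 1 then (1 : ℝ) else 0) * linKerAt (toSite r) L μ y (α', x')) / 2) := by ring
  rw [this, h, zero_div, mul_zero]

/-- NOT IN PRINT; OUR BOOKKEEPING.  **THE Λ-PIECE IS EXIT⊗EXIT-CHARGE-FREE AT EVERY SLOT** (box root; ANY `N`, ANY coefficient family `c` — in particular Bałaban's multiplier response
`lamCoeffOf KInv Lc` at level `0` and `lamCoeffK (KInvStep Lc (j+1)) (E2 …) Lc` at every level): `Σ'_{x′} 𝟙^{exit}_{α′}(x′)·Σ'_x 𝟙^{exit}_α(x)·SΛ κ u x x′ (inl α)(inl α′) = 0`. -/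
theorem tsum_exitFace_tsum_exitFace_SLam_hessFFAt_eq_zero {L : ℕ} (hL : 1 ≤ L) {r : Fin (d + 1) → ℕ} (hr : r ∈ box (d + 1) L)
    (c : Fin (d + 1) → (Fin (d + 1) → ℤ) → Fin (d + 1) → (Fin (d + 1) → ℤ) → ℝ) (κ : Fin (d + 1)) (u : Site (d + 1)) (α α' : Fin (d + 1)) :
    ∑' x', (if x' α' % (L : ℤ) = (L : ℤ) - 1 then (1 : ℝ) else 0) *
        ∑' x, (if x α % (L : ℤ) = (L : ℤ) - 1 then (1 : ℝ) else 0) * SLam N c (fun μ y => hessFFAt (toSite r) L μ y) κ u x x' (Sum.inl α) (Sum.inl α') = 0 := by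
  simp only [exitFace_mul_tsum_exitFace_SLam_hessFFAt_eq_zero hL hr, tsum_zero]

/-! ## §2 The exit⊗exit slot-charge function of the level-0 step table -/

/-- [folklore] **THE ff ENTRIES OF MEMBER `0`**: `SrecAt … 0 κ u x z (inl α)(inl β) = cE·W κ u x z (inl α)(inl β) + cΛ·SΛ κ u x z (inl α)(inl β)` with
`SΛ = SLam Lc (lamCoeffOf KInv Lc) (hessFFAt ρ Lc)` (the border table `vhSAt` is off the ff block; `SrecAt_eq_SpureRecAt_add_lam_zero` + g55's `spureRecAt_zero_inl_inl`). -/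
theorem srecAt_zero_inl_inl {Lc : ℕ} [NeZero Lc] (ρ : Fin (d + 1) → ℤ) (cE cVH cΛ : ℝ) (κ : Fin (d + 1)) (u x z : Site (d + 1)) (α β : Fin (d + 1)) :
    SrecAt d Lc ρ cE cVH cΛ 0 κ u x z (Sum.inl α) (Sum.inl β)
      = cE * wilsonA d κ u x z (Sum.inl α) (Sum.inl β)
        + cΛ * SLam Lc (lamCoeffOf (KInv (N := Lc) (d := d)) Lc) (fun μ y => hessFFAt ρ Lc μ y) κ u x z (Sum.inl α) (Sum.inl β) := by
  rw [SrecAt_eq_SpureRecAt_add_lam_zero]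
  simp only [Pi.add_apply, Pi.smul_apply, smul_eq_mul, spureRecAt_zero_inl_inl]

/-- NOT IN PRINT; OUR BOOKKEEPING.  **ONE EXIT LEG OF MEMBER `0`** (box root): by linearity, `Σ'_x 𝟙^{exit}_α(x)·(SrecAt … 0 κ u) x z (inl α)(inl β) = cE·(Wilson leg) + cΛ·(Λ leg)`. -/
theorem tsum_exitFace_mul_srecAt_zero_inl_inl {Lc : ℕ} [NeZero Lc] (hLc : 1 ≤ Lc) {r : Fin (d + 1) → ℕ} (hr : r ∈ box (d + 1) Lc) (cE cVH cΛ : ℝ)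
    (κ : Fin (d + 1)) (u z : Site (d + 1)) (α β : Fin (d + 1)) :
    ∑' x, (if x α % (Lc : ℤ) = (Lc : ℤ) - 1 then (1 : ℝ) else 0) * SrecAt d Lc (toSite r) cE cVH cΛ 0 κ u x z (Sum.inl α) (Sum.inl β)
      = cE * ∑' x, (if x α % (Lc : ℤ) = (Lc : ℤ) - 1 then (1 : ℝ) else 0) * wilsonA d κ u x z (Sum.inl α) (Sum.inl β)
        + cΛ * ∑' x, (if x α % (Lc : ℤ) = (Lc : ℤ) - 1 then (1 : ℝ) else 0) *
            SLam Lc (lamCoeffOf (KInv (N := Lc) (d := d)) Lc) (fun μ y => hessFFAt (toSite r) Lc μ y) κ u x z (Sum.inl α) (Sum.inl β) := by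
  have h1 := summable_mul_wilsonA κ u z α β (fun x => (if x α % (Lc : ℤ) = (Lc : ℤ) - 1 then (1 : ℝ) else 0))
  have h2 := summable_mul_SLam_hessFFAt (N := Lc) hLc hr (lamCoeffOf (KInv (N := Lc) (d := d)) Lc) κ u z α β
    (fun x => (if x α % (Lc : ℤ) = (Lc : ℤ) - 1 then (1 : ℝ) else 0))
  simp only [srecAt_zero_inl_inl]
  have e : ∀ x, (if x α % (Lc : ℤ) = (Lc : ℤ) - 1 then (1 : ℝ) else 0) *
        (cE * wilsonA d κ u x z (Sum.inl α) (Sum.inl β)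
          + cΛ * SLam Lc (lamCoeffOf (KInv (N := Lc) (d := d)) Lc) (fun μ y => hessFFAt (toSite r) Lc μ y) κ u x z (Sum.inl α) (Sum.inl β))
      = cE * ((if x α % (Lc : ℤ) = (Lc : ℤ) - 1 then (1 : ℝ) else 0) * wilsonA d κ u x z (Sum.inl α) (Sum.inl β))
        + cΛ * ((if x α % (Lc : ℤ) = (Lc : ℤ) - 1 then (1 : ℝ) else 0) *
            SLam Lc (lamCoeffOf (KInv (N := Lc) (d := d)) Lc) (fun μ y => hessFFAt (toSite r) Lc μ y) κ u x z (Sum.inl α) (Sum.inl β)) := fun x => by ring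
  rw [tsum_congr e, Summable.tsum_add (h1.mul_left cE) (h2.mul_left cΛ), tsum_mul_left, tsum_mul_left]

/-- NOT IN PRINT; OUR BOOKKEEPING.  **THE EXIT⊗EXIT SLOT-CHARGE FUNCTION OF THE LEVEL-0 STEP TABLE** (box root `ρ = toSite r`, `Lc ≥ 1`, every slot `(κ,u)`, every ff channel `(α,β)`):
`Σ'_z 𝟙^{exit}_β(z)·Σ'_x 𝟙^{exit}_α(x)·(SrecAt d Lc ρ cE cVH cΛ 0 κ u) x z (inl α)(inl β) = cE·(−¼)·(curvAdj (curv m_αβ)) κ u`, `m_αβ β′ z := dzψ_β β′ z·(ψ_α z + ψ_α(z+e_{β′}))`,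
`ψ_c = ⌊·_c∕Lc⌋` — the Wilson letter's share (g55 `WilsonLetterFaceCharge`); the Λ-piece contributes NOTHING (§1) and the border table has no ff block.  `u`-DEPENDENT: a lattice
Maxwell image of the face form read at the slot. -/
theorem tsum_exitFace_tsum_exitFace_srecAt_zero {Lc : ℕ} [NeZero Lc] (hLc : 1 ≤ Lc) {r : Fin (d + 1) → ℕ} (hr : r ∈ box (d + 1) Lc) (cE cVH cΛ : ℝ)
    (κ : Fin (d + 1)) (u : Site (d + 1)) (α β : Fin (d + 1)) :
    ∑' z, (if z β % (Lc : ℤ) = (Lc : ℤ) - 1 then (1 : ℝ) else 0) *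
        ∑' x, (if x α % (Lc : ℤ) = (Lc : ℤ) - 1 then (1 : ℝ) else 0) * SrecAt d Lc (toSite r) cE cVH cΛ 0 κ u x z (Sum.inl α) (Sum.inl β)
      = cE * (-(1 / 4 : ℝ) * curvAdj (curv (fun β' z => dz (fun w : Fin (d + 1) → ℤ => ((w β / (Lc : ℤ) : ℤ) : ℝ)) β' z
          * ((((z α / (Lc : ℤ) : ℤ) : ℝ)) + (((z + B6BondElimination.unitVec β') α / (Lc : ℤ) : ℤ) : ℝ)))) κ u) := by
  rw [← tsum_exitFace_wilsonA_exitFace_eq_neg_quarter_curvAdj hLc κ u α β, ← tsum_mul_left]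
  refine tsum_congr fun z => ?_
  rw [tsum_exitFace_mul_srecAt_zero_inl_inl hLc hr, mul_add, ← mul_assoc _ cΛ, mul_comm _ cΛ, mul_assoc cΛ,
    exitFace_mul_tsum_exitFace_SLam_hessFFAt_eq_zero hLc hr, mul_zero, add_zero]
  ring

/-- NOT IN PRINT; OUR BOOKKEEPING.  **SAME DIRECTION: `C^{exit}_0(κ,u;α,α) = 0`** at every slot (the Wilson share is a `d*d` of an exact form, g55 `…_self`). -/
theorem tsum_exitFace_tsum_exitFace_srecAt_zero_self {Lc : ℕ} [NeZero Lc] (hLc : 1 ≤ Lc) {r : Fin (d + 1) → ℕ} (hr : r ∈ box (d + 1) Lc) (cE cVH cΛ : ℝ)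
    (κ : Fin (d + 1)) (u : Site (d + 1)) (α : Fin (d + 1)) :
    ∑' z, (if z α % (Lc : ℤ) = (Lc : ℤ) - 1 then (1 : ℝ) else 0) *
        ∑' x, (if x α % (Lc : ℤ) = (Lc : ℤ) - 1 then (1 : ℝ) else 0) * SrecAt d Lc (toSite r) cE cVH cΛ 0 κ u x z (Sum.inl α) (Sum.inl α) = 0 := by
  have h0 := tsum_exitFace_wilsonA_exitFace_self (d := d) hLc κ u α
  rw [tsum_exitFace_wilsonA_exitFace_eq_neg_quarter_curvAdj hLc κ u α α] at h0
  rw [tsum_exitFace_tsum_exitFace_srecAt_zero hLc hr cE cVH cΛ κ u α α, h0, mul_zero]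

/-- NOT IN PRINT; OUR BOOKKEEPING.  **THE PURE-S TWIN** (no Λ-piece): `Σ'_z 𝟙^{exit}_β(z)·Σ'_x 𝟙^{exit}_α(x)·(SpureRecAt … 0 κ u) x z (inl α)(inl β)` has the same value
`cE·(−¼)·(curvAdj (curv m_αβ)) κ u` (the border table is off the ff block). -/
theorem tsum_exitFace_tsum_exitFace_spureRecAt_zero {Lc : ℕ} [NeZero Lc] (hLc : 1 ≤ Lc) (ρ : Fin (d + 1) → ℤ) (cE cVH cΛ : ℝ)
    (κ : Fin (d + 1)) (u : Site (d + 1)) (α β : Fin (d + 1)) :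
    ∑' z, (if z β % (Lc : ℤ) = (Lc : ℤ) - 1 then (1 : ℝ) else 0) *
        ∑' x, (if x α % (Lc : ℤ) = (Lc : ℤ) - 1 then (1 : ℝ) else 0) * SpureRecAt d Lc ρ cE cVH cΛ 0 κ u x z (Sum.inl α) (Sum.inl β)
      = cE * (-(1 / 4 : ℝ) * curvAdj (curv (fun β' z => dz (fun w : Fin (d + 1) → ℤ => ((w β / (Lc : ℤ) : ℤ) : ℝ)) β' z
          * ((((z α / (Lc : ℤ) : ℤ) : ℝ)) + (((z + B6BondElimination.unitVec β') α / (Lc : ℤ) : ℤ) : ℝ)))) κ u) := by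
  rw [← tsum_exitFace_wilsonA_exitFace_eq_neg_quarter_curvAdj hLc κ u α β, ← tsum_mul_left]
  refine tsum_congr fun z => ?_
  simp only [spureRecAt_zero_inl_inl]
  have e : ∀ x, (if x α % (Lc : ℤ) = (Lc : ℤ) - 1 then (1 : ℝ) else 0) * (cE * wilsonA d κ u x z (Sum.inl α) (Sum.inl β))
      = cE * ((if x α % (Lc : ℤ) = (Lc : ℤ) - 1 then (1 : ℝ) else 0) * wilsonA d κ u x z (Sum.inl α) (Sum.inl β)) := fun x => by ring
  rw [tsum_congr e, tsum_mul_left]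
  ring

end Summit.QuantumFields.BalabanUV.Beta.GAN24.SrecExitChargeLevelZero

end
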